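import Mathlib
import Summits.MatrixMultiplication.MatrixMultiplication.Theorems.FidelityWitnessesRankTwoAdditivityToolkit
import Summits.MatrixMultiplication.MatrixMultiplication.Theorems.FidelityWitnessesRankTwoAdditivityBalChain
import Summits.MatrixMultiplication.MatrixMultiplication.Theorems.FidelityWitnessesRankTwoAdditivityKeyBAL
import Summits.MatrixMultiplication.MatrixMultiplication.Theorems.FidelityWitnessesRankTwoAdditivityKeyME

/-!
# `FidelityWitnesses.RankTwoAdditivity` (stmt-MatrixMultiplication-4964) — key lemma (orthogonal components)

`one_sub_gram_psd`, the single-component bound `key_single`, orthonormality bookkeeping, the scaled balanced case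
`key_case_BAL`, and the key lemma for orthogonal components `key_lemma_orth`:
on the slice `Re ∑ π_ij ⟨φ_i,φ_j⟩ = ‖φ‖²` one has `F(φ) ≤ ‖φ‖²` (dichotomy `(π₀₀−1)(s₀−s₁)=0` into the maximally
entangled and balanced cases).  Supports item `stmt-MatrixMultiplication-4964`; no definitions are introduced.
-/

namespace Summit.MatrixMultiplication.MatrixMultiplication.Theorems.RankTwoAdditivity

open scoped BigOperators ComplexConjugate ComplexOrder Matrix

/-- `1 − D ⪰ 0` for the Gram matrix of `Q_k* b` with `b` a unit vector and `Q` HS-orthonormal (Cauchy–Schwarz). -/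
theorem one_sub_gram_psd {κ μ : Type*} [Fintype κ] [Fintype μ]
    (Q : Fin 2 → κ × μ → ℂ) (hQ : ∀ k l, (∑ c, conj (Q k c) * Q l c) = if k = l then 1 else 0)
    (b : κ → ℂ) (hb : (∑ m, ‖b m‖ ^ 2) = 1) :
    (1 - (Matrix.of fun k l : Fin 2 => ∑ c, conj (∑ m, conj (Q l (m, c)) * b m) * ∑ m, conj (Q k (m, c)) * b m)).PosSemidef := by
  set h0 : Fin 2 → μ → ℂ := fun k c => ∑ m, conj (Q k (m, c)) * b m with hh0
  have hD := gram_psd_fin_two h0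
  change (1 - (Matrix.of fun k l : Fin 2 => ∑ c, conj (h0 l c) * h0 k c)).PosSemidef
  apply Matrix.PosSemidef.of_dotProduct_mulVec_nonneg
  · exact Matrix.isHermitian_one.sub hD.1
  · intro x
    rw [Matrix.sub_mulVec, Matrix.one_mulVec, dotProduct_sub, gram_quad_fin_two h0 x]
    have hx : star x ⬝ᵥ x = ((∑ k, ‖x k‖ ^ 2 : ℝ) : ℂ) := by
      simp only [dotProduct, Pi.star_apply, Complex.star_def]; push_cast
      exact Finset.sum_congr rfl fun k _ => by rw [Complex.conj_mul']
    rw [hx]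
    have key : (∑ c, ‖∑ k, conj (x k) * h0 k c‖ ^ 2) ≤ ∑ k, ‖x k‖ ^ 2 := by
      have e : ∀ c, (∑ k, conj (x k) * h0 k c) = ∑ m, conj (∑ k, x k * Q k (m, c)) * b m := by
        intro c
        simp only [hh0, Finset.mul_sum, map_sum, map_mul, Finset.sum_mul]
        rw [Finset.sum_comm]
        exact Finset.sum_congr rfl fun m _ => Finset.sum_congr rfl fun k _ => by ring
      simp only [e]
      calc (∑ c, ‖∑ m, conj (∑ k, x k * Q k (m, c)) * b m‖ ^ 2)
          ≤ ∑ c, (∑ m, ‖∑ k, x k * Q k (m, c)‖ ^ 2) * ∑ m, ‖b m‖ ^ 2 :=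
            Finset.sum_le_sum fun c _ => norm_sq_hsum_le _ _
        _ = ∑ c, ∑ m, ‖∑ k, x k * Q k (m, c)‖ ^ 2 := by simp [hb]
        _ = ∑ k, ‖x k‖ ^ 2 := by
            rw [Finset.sum_comm, ← Fintype.sum_prod_type (fun c' : κ × μ => ‖∑ k, x k * Q k c'‖ ^ 2)]
            exact norm_sq_comb_orthonormal Q hQ x
    rw [Complex.nonneg_iff]
    constructor
    · simp only [Complex.sub_re, Complex.ofReal_re]; linarith
    · simp only [Complex.sub_im, Complex.ofReal_im]; simp

/-- Single-component bound: `∑_r ‖∑_k conj(w r (k,i₀)) Q_k* φ‖² ≤ (∑_r ∑_k |w r (k,i₀)|²) ‖φ‖²`. -/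
theorem key_single {κ μ : Type*} [Fintype κ] [Fintype μ]
    (Q : Fin 2 → κ × μ → ℂ) (hQ : ∀ k l, (∑ c, conj (Q k c) * Q l c) = if k = l then 1 else 0)
    (v : Fin 2 → Fin 2 → ℂ) (φ : κ → ℂ) :
    (∑ r, ∑ c, ‖∑ k, conj (v r k) * ∑ m, conj (Q k (m, c)) * φ m‖ ^ 2)
      ≤ (∑ r, ∑ k, ‖v r k‖ ^ 2) * ∑ m, ‖φ m‖ ^ 2 := by
  -- normalise φ
  obtain ⟨hble, hbeq, hdich⟩ := normalize_aux φ
  set n : ℝ := Real.sqrt (∑ m, ‖φ m‖ ^ 2) with hn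
  set b : κ → ℂ := fun m => (n : ℂ)⁻¹ * φ m with hbdef
  have hn2 : n ^ 2 = ∑ m, ‖φ m‖ ^ 2 := Real.sq_sqrt (Finset.sum_nonneg fun _ _ => by positivity)
  rcases hdich with hunit | hzero
  · -- φ = n • b with b unit
    set h0 : Fin 2 → μ → ℂ := fun k c => ∑ m, conj (Q k (m, c)) * b m with hh0
    have hg : ∀ k c, (∑ m, conj (Q k (m, c)) * φ m) = (n : ℂ) * h0 k c := by
      intro k c; simp only [hh0, Finset.mul_sum]
      exact Finset.sum_congr rfl fun m _ => by rw [hbeq m]; simp only [hbdef]; ring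
    simp only [hg]
    have e1 : ∀ r c, ‖∑ k, conj (v r k) * ((n : ℂ) * h0 k c)‖ ^ 2 = n ^ 2 * ‖∑ k, conj (v r k) * h0 k c‖ ^ 2 := by
      intro r c
      have : (∑ k, conj (v r k) * ((n : ℂ) * h0 k c)) = (n : ℂ) * ∑ k, conj (v r k) * h0 k c := by
        rw [Finset.mul_sum]; exact Finset.sum_congr rfl fun k _ => by ring
      rw [this, norm_mul, Complex.norm_real, Real.norm_of_nonneg (Real.sqrt_nonneg _), mul_pow]
    simp only [e1, ← Finset.mul_sum]
    rw [← hn2, mul_comm]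
    apply mul_le_mul_of_nonneg_right _ (by positivity)
    -- ∑_r ‖∑_k conj(v r k) h0 k‖² = Re tr(P D) ≤ Re tr P,  P = E Eᴴ with E k r = v r k, 1 − D ⪰ 0
    set E : Matrix (Fin 2) (Fin 2) ℂ := Matrix.of fun k r => v r k with hE
    set D : Matrix (Fin 2) (Fin 2) ℂ := Matrix.of fun k l : Fin 2 => ∑ c, conj (h0 l c) * h0 k c with hD
    have hDpsd : D.PosSemidef := gram_psd_fin_two h0
    have h1D : (1 - D).PosSemidef := by
      have := one_sub_gram_psd Q hQ b hunit
      simpa only [hh0] using this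
    have hP : (E * Eᴴ).PosSemidef := Matrix.posSemidef_self_mul_conjTranspose E
    have hnn := trace_mul_re_nonneg_fin_two _ _ hP h1D
    rw [Matrix.mul_sub, Matrix.mul_one, Matrix.trace_sub, Complex.sub_re] at hnn
    have nsq : ∀ z : ℂ, (z * conj z).re = ‖z‖ ^ 2 := fun z => by
      rw [Complex.mul_conj', ← Complex.ofReal_pow, Complex.ofReal_re]
    have eP : ((E * Eᴴ).trace).re = ∑ r, ∑ k, ‖v r k‖ ^ 2 := by
      simp only [Matrix.trace_fin_two, Matrix.mul_apply, Matrix.conjTranspose_apply, hE, Matrix.of_apply,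
        Complex.star_def, Fin.sum_univ_two, Complex.add_re, nsq]
      ring
    have ePD : ((E * Eᴴ) * D).trace = ∑ r, ∑ k, ∑ k', E k r * conj (E k' r) * ∑ i, conj (h0 k i) * h0 k' i := by
      simp only [Matrix.trace_fin_two, Matrix.mul_apply, Matrix.conjTranspose_apply, Complex.star_def, hD,
        Matrix.of_apply, Fin.sum_univ_two, hE]
      ring
    have ePDre : (((E * Eᴴ) * D).trace).re = ∑ r, ∑ c, ‖∑ k, conj (v r k) * h0 k c‖ ^ 2 := by
      rw [ePD, Complex.re_sum]
      refine Finset.sum_congr rfl fun r _ => ?_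
      rw [← ip_twist E h0 r r, Complex.re_sum]
      refine Finset.sum_congr rfl fun c _ => ?_
      simp only [hE, Matrix.of_apply]
      rw [Complex.conj_mul', ← Complex.ofReal_pow, Complex.ofReal_re]
    rw [eP, ePDre] at hnn
    linarith
  · -- φ = 0
    have hz : ∀ k c, (∑ m, conj (Q k (m, c)) * φ m) = 0 := fun k c =>
      Finset.sum_eq_zero fun m _ => by rw [hzero m, mul_zero]
    simp only [hz, mul_zero, Finset.sum_const_zero, norm_zero]
    have : ∀ m, ‖φ m‖ ^ 2 = 0 := fun m => by rw [hzero m]; simp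
    simp [this]

/-- From orthonormality of `w 0, w 1` in `ℂ^{2×2}`: the unit-norm / orthogonality facts in real form, and
`∑_i π_ii = 2`. -/
theorem orthonormal_pair_facts (w : Fin 2 → Fin 2 × Fin 2 → ℂ)
    (hw : ∀ r s, (∑ a, conj (w r a) * w s a) = if r = s then 1 else 0) :
    (∑ a, ‖w 0 a‖ ^ 2) = 1 ∧ (∑ a, ‖w 1 a‖ ^ 2) = 1 ∧ (∑ a, conj (w 0 a) * w 1 a) = 0
      ∧ (∑ r, ∑ k, ‖w r (k, 0)‖ ^ 2) + (∑ r, ∑ k, ‖w r (k, 1)‖ ^ 2) = 2 := by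
  have nrm : ∀ r, (∑ a, ‖w r a‖ ^ 2) = 1 := by
    intro r
    have h := congrArg Complex.re (hw r r)
    rw [Complex.re_sum] at h
    simp only [if_true, Complex.one_re, Complex.conj_mul', ← Complex.ofReal_pow, Complex.ofReal_re] at h
    exact h
  refine ⟨nrm 0, nrm 1, by rw [hw 0 1]; simp, ?_⟩
  have split : ∀ r, (∑ a, ‖w r a‖ ^ 2) = (∑ k, ‖w r (k, 0)‖ ^ 2) + ∑ k, ‖w r (k, 1)‖ ^ 2 := by
    intro r
    rw [Fintype.sum_prod_type, ← Finset.sum_add_distrib]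
    exact Finset.sum_congr rfl fun k _ => Fin.sum_univ_two _
  have h0 := nrm 0; have h1 := nrm 1
  rw [split] at h0 h1
  simp only [Fin.sum_univ_two] at h0 h1 ⊢
  linarith

/-- **Key lemma, balanced case (scaled).** As `key_case_BAL_unit`, for orthogonal `φ 0 ⊥ φ 1` of positive
norms `s₀, s₁`: `F ≤ s₀ + s₁`. -/
theorem key_case_BAL {κ μ : Type*} [Fintype κ] [Fintype μ]
    (Q : Fin 2 → κ × μ → ℂ) (hQ : ∀ k l, (∑ c, conj (Q k c) * Q l c) = if k = l then 1 else 0)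
    (w : Fin 2 → Fin 2 × Fin 2 → ℂ) (hw : ∀ r s, (∑ a, conj (w r a) * w s a) = if r = s then 1 else 0)
    (hbal : (∑ r, ∑ k, ‖w r (k, 0)‖ ^ 2) = 1)
    (φ : Fin 2 → κ → ℂ) (s₀ s₁ : ℝ) (hs₀ : (∑ m, ‖φ 0 m‖ ^ 2) = s₀) (hs₁ : (∑ m, ‖φ 1 m‖ ^ 2) = s₁)
    (hp₀ : 0 < s₀) (hp₁ : 0 < s₁) (horth : (∑ m, conj (φ 0 m) * φ 1 m) = 0) :
    (∑ r, ∑ c, ‖∑ a : Fin 2 × Fin 2, conj (w r a) * ∑ m, conj (Q a.1 (m, c)) * φ a.2 m‖ ^ 2) ≤ s₀ + s₁ := by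
  -- normalise
  set n : Fin 2 → ℝ := fun i => Real.sqrt (∑ m, ‖φ i m‖ ^ 2) with hn
  set b : Fin 2 → κ → ℂ := fun i m => ((n i : ℝ) : ℂ)⁻¹ * φ i m with hb
  have hn0 : n 0 = Real.sqrt s₀ := by simp only [hn, hs₀]
  have hn1 : n 1 = Real.sqrt s₁ := by simp only [hn, hs₁]
  have hnpos : ∀ i, 0 < n i := by
    intro i; fin_cases i
    · show 0 < n 0; rw [hn0]; exact Real.sqrt_pos.2 hp₀
    · show 0 < n 1; rw [hn1]; exact Real.sqrt_pos.2 hp₁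
  have hφ : ∀ i m, φ i m = (n i : ℂ) * b i m := by
    intro i m; simp only [hb]
    rw [← mul_assoc, mul_inv_cancel₀ (by exact_mod_cast (hnpos i).ne'), one_mul]
  have hbunit : ∀ i, (∑ m, ‖b i m‖ ^ 2) = 1 := by
    intro i
    have : (∑ m, ‖b i m‖ ^ 2) = (n i)⁻¹ ^ 2 * ∑ m, ‖φ i m‖ ^ 2 := by
      rw [Finset.mul_sum]; refine Finset.sum_congr rfl fun m _ => ?_
      simp only [hb]; rw [norm_mul, norm_inv, Complex.norm_real, Real.norm_of_nonneg (hnpos i).le, mul_pow]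
    rw [this]
    have h2 : (n i) ^ 2 = ∑ m, ‖φ i m‖ ^ 2 := Real.sq_sqrt (Finset.sum_nonneg fun _ _ => by positivity)
    rw [← h2, inv_pow, inv_mul_cancel₀ (pow_ne_zero 2 (hnpos i).ne')]
  have hborth : (∑ m, conj (b 0 m) * b 1 m) = 0 := by
    have : (∑ m, conj (b 0 m) * b 1 m) = ((n 0 : ℂ))⁻¹ * ((n 1 : ℂ))⁻¹ * ∑ m, conj (φ 0 m) * φ 1 m := by
      rw [Finset.mul_sum]; refine Finset.sum_congr rfl fun m _ => ?_
      simp only [hb, map_mul, map_inv₀, Complex.conj_ofReal]; ring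
    rw [this, horth, mul_zero]
  obtain ⟨hmain, hu, hv⟩ := key_case_BAL_unit Q hQ w hw hbal b (hbunit 0) (hbunit 1) hborth
  -- name the unit quantities
  set h : Fin 2 → Fin 2 → μ → ℂ := fun k i c => ∑ m, conj (Q k (m, c)) * b i m with hh
  set A : Fin 2 → μ → ℂ := fun r c => ∑ k, conj (w r (k, 0)) * h k 0 c with hA
  set B : Fin 2 → μ → ℂ := fun r c => ∑ k, conj (w r (k, 1)) * h k 1 c with hB
  change ‖∑ r, ∑ c, conj (A r c) * B r c‖ ^ 2 ≤ (1 - ∑ r, ∑ c, ‖A r c‖ ^ 2) * (1 - ∑ r, ∑ c, ‖B r c‖ ^ 2) at hmain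
  change 0 ≤ 1 - ∑ r, ∑ c, ‖A r c‖ ^ 2 at hu
  change 0 ≤ 1 - ∑ r, ∑ c, ‖B r c‖ ^ 2 at hv
  set u : ℝ := 1 - ∑ r, ∑ c, ‖A r c‖ ^ 2 with hudef
  set v : ℝ := 1 - ∑ r, ∑ c, ‖B r c‖ ^ 2 with hvdef
  set c₀ : ℂ := ∑ r, ∑ c, conj (A r c) * B r c with hc₀
  -- decompose F
  have hdec : ∀ r c, (∑ a : Fin 2 × Fin 2, conj (w r a) * ∑ m, conj (Q a.1 (m, c)) * φ a.2 m)
      = (n 0 : ℂ) * A r c + (n 1 : ℂ) * B r c := by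
    intro r c
    have hG : ∀ k i, (∑ m, conj (Q k (m, c)) * φ i m) = (n i : ℂ) * h k i c := by
      intro k i
      simp only [hh, Finset.mul_sum]
      exact Finset.sum_congr rfl fun m _ => by rw [hφ i m]; ring
    rw [Fintype.sum_prod_type]
    simp only [Fin.sum_univ_two, hG, hA, hB]
    ring
  simp only [hdec]
  have hF : (∑ r, ∑ c, ‖(n 0 : ℂ) * A r c + (n 1 : ℂ) * B r c‖ ^ 2)
      = s₀ * (∑ r, ∑ c, ‖A r c‖ ^ 2) + s₁ * (∑ r, ∑ c, ‖B r c‖ ^ 2) + 2 * (n 0 * n 1) * c₀.re := by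
    have per : ∀ r, (∑ c, ‖(n 0 : ℂ) * A r c + (n 1 : ℂ) * B r c‖ ^ 2)
        = s₀ * (∑ c, ‖A r c‖ ^ 2) + s₁ * (∑ c, ‖B r c‖ ^ 2) + 2 * (n 0 * n 1) * (∑ c, conj (A r c) * B r c).re := by
      intro r
      rw [norm_sq_add_sum]
      have e1 : (∑ c, ‖(n 0 : ℂ) * A r c‖ ^ 2) = s₀ * ∑ c, ‖A r c‖ ^ 2 := by
        rw [Finset.mul_sum]; refine Finset.sum_congr rfl fun c _ => ?_
        rw [norm_mul, Complex.norm_real, Real.norm_of_nonneg (hnpos 0).le, mul_pow, hn0, Real.sq_sqrt hp₀.le]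
      have e2 : (∑ c, ‖(n 1 : ℂ) * B r c‖ ^ 2) = s₁ * ∑ c, ‖B r c‖ ^ 2 := by
        rw [Finset.mul_sum]; refine Finset.sum_congr rfl fun c _ => ?_
        rw [norm_mul, Complex.norm_real, Real.norm_of_nonneg (hnpos 1).le, mul_pow, hn1, Real.sq_sqrt hp₁.le]
      have e3 : (∑ c, conj ((n 0 : ℂ) * A r c) * ((n 1 : ℂ) * B r c)) = ((n 0 * n 1 : ℝ) : ℂ) * ∑ c, conj (A r c) * B r c := by
        push_cast; rw [Finset.mul_sum]; refine Finset.sum_congr rfl fun c _ => ?_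
        rw [map_mul, Complex.conj_ofReal]; ring
      rw [e1, e2, e3, Complex.re_ofReal_mul]; ring
    simp only [per, Finset.sum_add_distrib, ← Finset.mul_sum, hc₀, Complex.re_sum]
  rw [hF]
  -- the AM-GM finish
  have hnn : 0 ≤ n 0 * n 1 := mul_nonneg (hnpos 0).le (hnpos 1).le
  have hρ2 : (n 0 * n 1) ^ 2 = s₀ * s₁ := by
    rw [mul_pow, hn0, hn1, Real.sq_sqrt hp₀.le, Real.sq_sqrt hp₁.le]
  have hre : c₀.re ^ 2 ≤ u * v := by
    have : c₀.re ^ 2 ≤ ‖c₀‖ ^ 2 := by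
      rw [Complex.sq_norm, Complex.normSq_apply]; nlinarith [sq_nonneg c₀.im]
    exact le_trans this hmain
  have hcross : 2 * (n 0 * n 1) * c₀.re ≤ s₀ * u + s₁ * v := by
    by_cases hc : c₀.re ≤ 0
    · have : 0 ≤ s₀ * u + s₁ * v := by positivity
      nlinarith
    · push Not at hc
      have h4 : (2 * (n 0 * n 1) * c₀.re) ^ 2 ≤ (s₀ * u + s₁ * v) ^ 2 := by
        have : (2 * (n 0 * n 1) * c₀.re) ^ 2 = 4 * (s₀ * s₁) * c₀.re ^ 2 := by rw [← hρ2]; ring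
        rw [this]
        nlinarith [sq_nonneg (s₀ * u - s₁ * v), mul_le_mul_of_nonneg_left hre (by positivity : (0:ℝ) ≤ 4 * (s₀ * s₁)),
          mul_nonneg hp₀.le hu, mul_nonneg hp₁.le hv]
      have hb' : 0 ≤ s₀ * u + s₁ * v := by positivity
      nlinarith [abs_le_of_sq_le_sq' h4 hb']
  have eu : (∑ r, ∑ c, ‖A r c‖ ^ 2) = 1 - u := by rw [hudef]; ring
  have ev : (∑ r, ∑ c, ‖B r c‖ ^ 2) = 1 - v := by rw [hvdef]; ring
  rw [eu, ev]
  nlinarith [hcross]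

/-- **Key lemma (orthogonal components).** For HS-orthonormal `Q`, orthonormal `w 0, w 1 ∈ ℂ^{2×2}` (a rank-two
projector `Π`), and `φ 0 ⊥ φ 1` on the slice `Re ∑_{ij} π_ij ⟨φ_i,φ_j⟩ = ‖φ‖²` (`π = Tr₁ Π`):
`F(φ) = ∑_r ‖∑_{(k,i)} conj(w r (k,i)) Q_k* φ_i‖² ≤ ‖φ‖²`. -/
theorem key_lemma_orth {κ μ : Type*} [Fintype κ] [Fintype μ]
    (Q : Fin 2 → κ × μ → ℂ) (hQ : ∀ k l, (∑ c, conj (Q k c) * Q l c) = if k = l then 1 else 0)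
    (w : Fin 2 → Fin 2 × Fin 2 → ℂ) (hw : ∀ r s, (∑ a, conj (w r a) * w s a) = if r = s then 1 else 0)
    (φ : Fin 2 → κ → ℂ) (horth : (∑ m, conj (φ 0 m) * φ 1 m) = 0)
    (hslice : (∑ i, ∑ j, (∑ r, ∑ k, w r (k, i) * conj (w r (k, j))) * ∑ m, conj (φ i m) * φ j m).re
      = ∑ i, ∑ m, ‖φ i m‖ ^ 2) :
    (∑ r, ∑ c, ‖∑ a : Fin 2 × Fin 2, conj (w r a) * ∑ m, conj (Q a.1 (m, c)) * φ a.2 m‖ ^ 2)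
      ≤ ∑ i, ∑ m, ‖φ i m‖ ^ 2 := by
  obtain ⟨hw₀, hw₁, hw₀₁, hπ⟩ := orthonormal_pair_facts w hw
  set s₀ : ℝ := ∑ m, ‖φ 0 m‖ ^ 2 with hs₀
  set s₁ : ℝ := ∑ m, ‖φ 1 m‖ ^ 2 with hs₁
  set p₀ : ℝ := ∑ r, ∑ k, ‖w r (k, 0)‖ ^ 2 with hp₀
  set p₁ : ℝ := ∑ r, ∑ k, ‖w r (k, 1)‖ ^ 2 with hp₁
  have htot : (∑ i, ∑ m, ‖φ i m‖ ^ 2) = s₀ + s₁ := by rw [Fin.sum_univ_two]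
  rw [htot] at hslice ⊢
  -- read off the slice condition: p₀ s₀ + p₁ s₁ = s₀ + s₁
  have horth' : (∑ m, conj (φ 1 m) * φ 0 m) = 0 := by
    have : (∑ m, conj (φ 1 m) * φ 0 m) = conj (∑ m, conj (φ 0 m) * φ 1 m) := by
      rw [map_sum]; exact Finset.sum_congr rfl fun m _ => by rw [map_mul, Complex.conj_conj, mul_comm]
    rw [this, horth, map_zero]
  have hdiag : ∀ i, ((∑ r, ∑ k, w r (k, i) * conj (w r (k, i))) * ∑ m, conj (φ i m) * φ i m).re
      = (∑ r, ∑ k, ‖w r (k, i)‖ ^ 2) * ∑ m, ‖φ i m‖ ^ 2 := by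
    intro i
    have e1 : (∑ r, ∑ k, w r (k, i) * conj (w r (k, i))) = ((∑ r, ∑ k, ‖w r (k, i)‖ ^ 2 : ℝ) : ℂ) := by
      push_cast; exact Finset.sum_congr rfl fun r _ => Finset.sum_congr rfl fun k _ => by rw [Complex.mul_conj']
    have e2 : (∑ m, conj (φ i m) * φ i m) = ((∑ m, ‖φ i m‖ ^ 2 : ℝ) : ℂ) := by
      push_cast; exact Finset.sum_congr rfl fun m _ => by rw [Complex.conj_mul']
    rw [e1, e2, ← Complex.ofReal_mul, Complex.ofReal_re]
  have hsl : p₀ * s₀ + p₁ * s₁ = s₀ + s₁ := by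
    set T : Fin 2 → Fin 2 → ℝ := fun i j =>
      ((∑ r, ∑ k, w r (k, i) * conj (w r (k, j))) * ∑ m, conj (φ i m) * φ j m).re with hT
    have hsum : (∑ i, ∑ j, T i j) = s₀ + s₁ := by
      rw [← hslice, Complex.re_sum]
      exact Finset.sum_congr rfl fun i _ => by rw [Complex.re_sum]
    simp only [Fin.sum_univ_two] at hsum
    have T01 : T 0 1 = 0 := by simp only [hT, horth, mul_zero, Complex.zero_re]
    have T10 : T 1 0 = 0 := by simp only [hT, horth', mul_zero, Complex.zero_re]
    have T00 : T 0 0 = p₀ * s₀ := by simp only [hT]; exact hdiag 0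
    have T11 : T 1 1 = p₁ * s₁ := by simp only [hT]; exact hdiag 1
    rw [T01, T10, T00, T11] at hsum
    linarith
  have hkey : (p₀ - 1) * (s₀ - s₁) = 0 := by
    have e : p₁ = 2 - p₀ := by linarith
    rw [e] at hsl
    linear_combination hsl
  rcases mul_eq_zero.1 hkey with hcase | hcase
  · -- balanced case p₀ = 1 (hence p₁ = 1)
    have hb0 : p₀ = 1 := by linarith
    have hb1 : p₁ = 1 := by linarith
    have hs₀nn : 0 ≤ s₀ := Finset.sum_nonneg fun _ _ => by positivity
    have hs₁nn : 0 ≤ s₁ := Finset.sum_nonneg fun _ _ => by positivity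
    -- single-component reductions
    have zero_comp : ∀ i, (∑ m, ‖φ i m‖ ^ 2) = 0 → ∀ k c, (∑ m, conj (Q k (m, c)) * φ i m) = 0 := by
      intro i hi k c
      have hz : ∀ m, φ i m = 0 := fun m => by
        have := (Finset.sum_eq_zero_iff_of_nonneg fun m _ => by positivity).1 hi m (Finset.mem_univ m)
        exact norm_eq_zero.1 ((pow_eq_zero_iff two_ne_zero).1 this)
      exact Finset.sum_eq_zero fun m _ => by rw [hz m, mul_zero]
    rcases hs₁nn.lt_or_eq with h1 | h1
    · rcases hs₀nn.lt_or_eq with h0 | h0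
      · exact key_case_BAL Q hQ w hw hb0 φ s₀ s₁ rfl rfl h0 h1 horth
      · -- s₀ = 0
        have hz := zero_comp 0 h0.symm
        have hred : ∀ r c, (∑ a : Fin 2 × Fin 2, conj (w r a) * ∑ m, conj (Q a.1 (m, c)) * φ a.2 m)
            = ∑ k, conj (w r (k, 1)) * ∑ m, conj (Q k (m, c)) * φ 1 m := by
          intro r c
          rw [Fintype.sum_prod_type]
          refine Finset.sum_congr rfl fun k _ => ?_
          rw [Fin.sum_univ_two, hz k c, mul_zero, zero_add]
        simp only [hred]
        have := key_single Q hQ (fun r k => w r (k, 1)) (φ 1)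
        rw [← hp₁, hb1, one_mul] at this
        linarith
    · -- s₁ = 0
      have hz := zero_comp 1 h1.symm
      have hred : ∀ r c, (∑ a : Fin 2 × Fin 2, conj (w r a) * ∑ m, conj (Q a.1 (m, c)) * φ a.2 m)
          = ∑ k, conj (w r (k, 0)) * ∑ m, conj (Q k (m, c)) * φ 0 m := by
        intro r c
        rw [Fintype.sum_prod_type]
        refine Finset.sum_congr rfl fun k _ => ?_
        rw [Fin.sum_univ_two, hz k c, mul_zero, add_zero]
      simp only [hred]
      have := key_single Q hQ (fun r k => w r (k, 0)) (φ 0)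
      rw [← hp₀, hb0, one_mul] at this
      linarith
  · -- maximally entangled case s₀ = s₁
    have hs : s₀ = s₁ := by linarith
    have := key_case_ME Q (fun k => ?_) w hw₀ hw₁ hw₀₁ φ s₀ rfl (by rw [hs]) horth
    · linarith
    · -- ‖Q k‖² = 1 from hQ k k
      have h := congrArg Complex.re (hQ k k)
      rw [Complex.re_sum] at h
      simp only [if_true, Complex.one_re, Complex.conj_mul', ← Complex.ofReal_pow, Complex.ofReal_re] at h
      exact h

end Summit.MatrixMultiplication.MatrixMultiplication.Theorems.RankTwoAdditivity
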